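import Summits.CriticalPhenomena.CardyFormulaZ2.Theorems.CardyComplexConeEdgePrecompactUFRSFaceExit
import Summits.CriticalPhenomena.CardyFormulaZ2.Theorems.CardyComplexConeEdgePrecompactUFRSDiscrepancyEdges

/-!
# The last departure of the second run from the first stretch: three corner-disjoint strands at a discrepancy corner
(line `qkz-strip-boundary-arm` of crux `CardyComplexCone.EdgePrecompact`, stmt-CriticalPhenomena-11387;
item 3 of the road map for the uniform forward response stability "UFRS", module docstring of
`Theorems/CardyComplexConeEdgePrecompactUniformForwardResponseStability.lean`)

Setting of `ufrs_failureStructure` / `splitStrands` (`…UFRSFailureStructure.lean`,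
`…UFRSStrands.lean`): the simple `β₀`-stretch `S₀ = O₀ a [0, n]` (from the start corner `a`, or
from an exit corner of the ball, re-entering the ball at time `n`), a corner `e = O₀ a m` on it,
and the run `O₁ e [0, T]` of the second dynamics `β₁ = (shiftData E w).bcBondConfig ω` (good
stretch, then entry into the ball or exit from the inner faces of `E₁ = shiftData E w`). The road
map's "three pairwise dart-disjoint strands at `cTgt e`" fails as stated: the run may merge into
the incoming whisker `O₀ a [0, m)` (`whiskerContact`, `run_whisker_trichotomy`) and, in case (B),
returns to `O₀ a (m, n]`. This file gives the statement that DOES hold in all cases, at the price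
of moving the base corner along `S₀`: look at the LAST CONTACT `O₁ e j = O₀ a i` of the run with
the whole stretch `S₀` (`lastContact`; `j = 0`, `i = m` is a contact, so it exists).

* After it the run is FREE: `O₁ e (j, T]` shares no corner with `S₀`; so the three strands
  `O₀ a [0, i)`, `O₀ a (i, n]`, `O₁ e (j, T]` at the corner `ζ = O₀ a i` are pairwise
  corner-disjoint (the first two by simplicity of `S₀`), the second ends in the ball, the first
  starts at `a`, the third ends where the run ends.
* If `j < T` (the free part is nonempty), the two successors of `ζ` differ — they are the two
  out-darts of the medial vertex `cTgt ζ` — so `cTgt ζ` is a DISCREPANCY edge (different status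
  in `β₀`, `β₁`; opposite turns); in UFRS it lies in the `3η`-collar (`collarAgreement`,
  `no_discrepancy_of_agree`) and touches one of the four discrete arcs (`ufrs_discrepancyEdges`).
* If `j = T` the run ENDS on `S₀`: entering the ball, necessarily at the re-entry corner
  `O₀ a n` itself (a slipped return, case (B)); or leaving the inner faces of `E₁`, and then the
  contact corner `O₀ a i` IS the exit corner of `E₁` (`orbit_exit_or_stuck`; the stuck alternative
  is excluded for a start corner and for a deep exit corner of the ball, as in `ufrs_faceExit`):
  the `β₀`-stretch passes through the exit corner of the translate — a marked-point event.

`ufrs_lastDeparture` is the UFRS-vocabulary form (fine admissible data of `D`, shift `‖E.δ w‖ < η`,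
ball `B(E.δ v, ρ)` with `4η ≤ ρ`, centre `2ρ`-deep).

References: S. Smirnov, C. R. Acad. Sci. Paris 333 (2001), §2; G. Grimmett, *The Random-Cluster
Model* (2006), §6.1 (loops do not cross); P. Nolin, Electron. J. Probab. 13 (2008), §4.
-/

namespace Summit.CriticalPhenomena.CardyFormulaZ2.Cruxes.EdgePrecompact.QkzStripBoundaryArm

open MeasureTheory Filter Set Metric
open scoped Topology BigOperators Pointwise
open Literature.Probability.LatticeModels Literature.Probability.Percolation
open Literature.Probability.RandomPlanarGeometry (DobrushinDomain)
open Summit.CriticalPhenomena.CardyFormulaZ2.Theses.CardyComplexCone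

noncomputable section

/-! ## Elementary facts -/

/-- A greatest index `j ≤ T` satisfying a predicate that holds at `0`. -/
private theorem exists_greatest_le_U4 (P : ℕ → Prop) (T : ℕ) (h0 : P 0) :
    ∃ j, j ≤ T ∧ P j ∧ ∀ j', j < j' → j' ≤ T → ¬ P j' := by
  classical
  exact ⟨Nat.findGreatest P T, Nat.findGreatest_le T,
    Nat.findGreatest_spec (P := P) (Nat.zero_le T) h0,
    fun j' h1 h2 => Nat.findGreatest_is_greatest h1 h2⟩

/-- **Different status, opposite turns**: if the target edge of `p` has different status in
`β₀` and `β₁`, the two dynamics turn by opposite right angles at `p`. -/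
theorem turnOf_ne_of_not_iff {β₀ β₁ : BondConfig (Site 2)} {p : Site 2 × Fin 4}
    (h : ¬ (cTgt p ∈ β₀ ↔ cTgt p ∈ β₁)) : turnOf β₁ p ≠ turnOf β₀ p := by
  intro ht
  apply h
  simp only [turnOf] at ht
  by_cases h₀ : cTgt p ∈ β₀
  · by_cases h₁ : cTgt p ∈ β₁
    · exact ⟨fun _ => h₁, fun _ => h₀⟩
    · rw [if_pos h₀, if_neg h₁] at ht
      linarith [Real.pi_pos]
  · by_cases h₁ : cTgt p ∈ β₁
    · rw [if_neg h₀, if_pos h₁] at ht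
      linarith [Real.pi_pos]
    · exact ⟨fun h => absurd h h₀, fun h => absurd h h₁⟩

/-- **Different successors, different status**: if the two dynamics send `p` to different
corners, its target edge has different status in `β₀` and `β₁`. -/
theorem not_iff_of_nextCorner_ne {β₀ β₁ : BondConfig (Site 2)} {p : Site 2 × Fin 4}
    (h : nextCorner β₀ p ≠ nextCorner β₁ p) : ¬ (cTgt p ∈ β₀ ↔ cTgt p ∈ β₁) :=
  fun hiff => h (nextCorner_congr_of_iff hiff)

/-! ## The last contact of the second run with the first stretch -/

/-- **Last contact** (combinatorial core, arbitrary dynamics `β₀, β₁`). Data: the stretch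
`O₀ c₀ [0, n]` with targets off `I` before `n` and target in `I` at `n`, a corner `e = O₀ c₀ m`
on it (`m ≤ n`), and a run `O₁ e [0, T]` of the second dynamics with targets off `I` before `T`.
CONCLUSION: there is a LAST contact `O₁ e j = O₀ c₀ i` (`j ≤ T`, `i ≤ n`): no later corner
`O₁ e j'`, `j < j' ≤ T`, lies on the stretch; if `j < T` then `i < n`, the successors
`O₁ e (j + 1) ≠ O₀ c₀ (i + 1)` are the two out-darts of the medial vertex `cTgt (O₀ c₀ i)`, and
that edge has different status in `β₀` and `β₁` (opposite turns); if `j = T` and the run enters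
`I` at `T`, the contact is the re-entry corner itself (`i = n`). -/
theorem lastContact (β₀ β₁ : BondConfig (Site 2)) (I : Set (Sym2 (Site 2))) (c₀ e : Site 2 × Fin 4)
    (m n T : ℕ) (hmn : m ≤ n) (he : cornerOrbit β₀ c₀ m = e)
    (hStr : ∀ i < n, cTgt (cornerOrbit β₀ c₀ i) ∉ I) (hin : cTgt (cornerOrbit β₀ c₀ n) ∈ I)
    (hrun : ∀ j < T, cTgt (cornerOrbit β₁ e j) ∉ I) :
    ∃ j i : ℕ, j ≤ T ∧ i ≤ n ∧ cornerOrbit β₁ e j = cornerOrbit β₀ c₀ i ∧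
      (∀ j', j < j' → j' ≤ T → ∀ i' ≤ n, cornerOrbit β₁ e j' ≠ cornerOrbit β₀ c₀ i') ∧
      (j < T → i < n ∧ cornerOrbit β₁ e (j + 1) ≠ cornerOrbit β₀ c₀ (i + 1) ∧
        cSrc (cornerOrbit β₁ e (j + 1)) = cTgt (cornerOrbit β₀ c₀ i) ∧
        cSrc (cornerOrbit β₀ c₀ (i + 1)) = cTgt (cornerOrbit β₀ c₀ i) ∧
        ¬ (cTgt (cornerOrbit β₀ c₀ i) ∈ β₀ ↔ cTgt (cornerOrbit β₀ c₀ i) ∈ β₁) ∧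
        turnOf β₁ (cornerOrbit β₀ c₀ i) ≠ turnOf β₀ (cornerOrbit β₀ c₀ i)) ∧
      (j = T → cTgt (cornerOrbit β₁ e T) ∈ I → i = n) := by
  obtain ⟨j, hjT, ⟨i, hin', hEq⟩, hmax⟩ := exists_greatest_le_U4
    (fun j => ∃ i ≤ n, cornerOrbit β₁ e j = cornerOrbit β₀ c₀ i) T ⟨m, hmn, he.symm⟩
  refine ⟨j, i, hjT, hin', hEq, fun j' h1 h2 i' hi' hEq' => hmax j' h1 h2 ⟨i', hi', hEq'⟩,
    fun hjlt => ?_, fun hjE hI => ?_⟩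
  · -- the free part is nonempty: the contact is before `n`, the successors differ
    have hi : i < n := by
      by_contra hge
      have hieq : i = n := le_antisymm hin' (not_lt.1 hge)
      refine hrun j hjlt ?_
      rw [hEq, hieq]
      exact hin
    have hne : cornerOrbit β₁ e (j + 1) ≠ cornerOrbit β₀ c₀ (i + 1) := fun h =>
      hmax (j + 1) (Nat.lt_succ_self j) hjlt ⟨i + 1, hi, h⟩
    have hne' : nextCorner β₀ (cornerOrbit β₀ c₀ i) ≠ nextCorner β₁ (cornerOrbit β₀ c₀ i) := by
      intro h
      apply hne
      show nextCorner β₁ (cornerOrbit β₁ e j) = nextCorner β₀ (cornerOrbit β₀ c₀ i)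
      rw [hEq]
      exact h.symm
    have hst := not_iff_of_nextCorner_ne hne'
    refine ⟨hi, hne, ?_, cSrc_nextCorner _, hst, turnOf_ne_of_not_iff hst⟩
    show cSrc (nextCorner β₁ (cornerOrbit β₁ e j)) = _
    rw [hEq]
    exact cSrc_nextCorner _
  · -- the run ends on the stretch by entering `I`: at the re-entry corner
    subst hjE
    by_contra hne
    have hi : i < n := lt_of_le_of_ne hin' hne
    exact hStr i hi (by rw [← hEq]; exact hI)

/-- **The three strands at the last contact are pairwise corner-disjoint.** With the stretch
`O₀ c₀ [0, n]` simple, the incoming part `O₀ c₀ [0, i)`, the outgoing part `O₀ c₀ (i, n]` and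
the free part `O₁ e (j, T]` of the run share no corner. -/
theorem lastContact_disjoint {β₀ β₁ : BondConfig (Site 2)} {c₀ e : Site 2 × Fin 4} {n T j i : ℕ}
    (hsimple : ∀ i₁ i₂ : ℕ, i₁ ≤ n → i₂ ≤ n → cornerOrbit β₀ c₀ i₁ = cornerOrbit β₀ c₀ i₂ → i₁ = i₂)
    (hfree : ∀ j', j < j' → j' ≤ T → ∀ i' ≤ n, cornerOrbit β₁ e j' ≠ cornerOrbit β₀ c₀ i') :
    (∀ i₁ i₂ : ℕ, i₁ < i → i < i₂ → i₂ ≤ n → cornerOrbit β₀ c₀ i₁ ≠ cornerOrbit β₀ c₀ i₂) ∧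
    (∀ j', j < j' → j' ≤ T → ∀ i₁, i₁ < i → i ≤ n → cornerOrbit β₁ e j' ≠ cornerOrbit β₀ c₀ i₁) ∧
    (∀ j', j < j' → j' ≤ T → ∀ i₂, i < i₂ → i₂ ≤ n → cornerOrbit β₁ e j' ≠ cornerOrbit β₀ c₀ i₂) := by
  refine ⟨fun i₁ i₂ h1 h2 h3 h => ?_, fun j' h1 h2 i₁ hi₁ hin h => hfree j' h1 h2 i₁ (by omega) h,
    fun j' h1 h2 i₂ _ hi₂ h => hfree j' h1 h2 i₂ hi₂ h⟩
  have := hsimple i₁ i₂ (by omega) h3 h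
  omega

/-! ## In UFRS: the last departure sits at a collar discrepancy edge, or the run ends on the stretch -/

/-- **The last departure of the second run** (UFRS vocabulary; consumes the data of the SPLIT
branch of `ufrs_failureStructure`, but needs neither the split at `e` nor the mismatch clause).
For `η > 0` there is `δ₀ > 0` such that for every admissible datum `E` of `D` with `E.δ < δ₀`,
shift `w` with `‖E.δ w‖ < η`, ball `B(E.δ v, ρ)` with `4η ≤ ρ` and `2ρ ≤ infDist (E.δ v) Dᶜ`,
configuration `ω`, admissible pair `(a, a')`, good `β₀`-stretch `O₀ a [0, n]` re-entering the ball
at `n`, index `m ≤ n` whose corner `e = O₀ a m` is reached by the `β₁`-orbit of `a'` at time `k`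
through inner faces of `E₁ = shiftData E w`, and run end `T` of the `β₁`-orbit of `e`: with
`ζ = O₀ a i` the LAST contact `O₁ e j = O₀ a i` of the run with the stretch (`lastContact`),
(1) the stretch is simple and the free part `O₁ e (j, T]` avoids it; (2) `j = 0` forces `i = m`;
(3) if `j < T`: the successors of `ζ` under the two dynamics are the two distinct out-darts of
`cTgt ζ`, a discrepancy edge with opposite turns, the vertex of `ζ` lies in the `3η`-collar of
`∂D` and `cTgt ζ` has an endpoint on one of the four discrete arcs; (4) if `j = T`: either the
run enters the ball at `T` and `i = n` (slipped return to the re-entry corner), or it leaves the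
inner faces of `E₁` at `T + 1` and `ζ` is THE exit corner of `E₁` (vertex on `A₁`, target edge an
`A₁B₁`-edge read at its `A₁`-end, closed in `β₁`, every exit-type corner of `E₁` equals `ζ`), in
the `3η`-collar. -/
theorem ufrs_lastDeparture : ∀ (D : DobrushinDomain) (η : ℝ), 0 < η → ∃ δ₀ > (0:ℝ), ∀ E : DiscreteDobrushin, E.Ω = D.carrier → E.IsZdAdmissible → E.δ < δ₀ → ∀ (v w : Site 2) (ρ : ℝ), 4 * η ≤ ρ → 2 * ρ ≤ infDist (meshPoint E.δ v) D.carrierᶜ → ‖meshPoint E.δ w‖ < η → ∀ (ω : BondConfig (Site 2)) (a a' : Site 2 × Fin 4) (n m k T : ℕ), ((E.IsStartCorner a ∧ (shiftData E w).IsStartCorner a') ∨ (a = a' ∧ medialPoint E.δ (cSrc a) ∈ ball (meshPoint E.δ v) ρ ∧ medialPoint E.δ (cTgt a) ∉ ball (meshPoint E.δ v) ρ)) → (∀ i < n, medialPoint E.δ (cTgt (cornerOrbit (E.bcBondConfig ω) a i)) ∉ ball (meshPoint E.δ v) ρ ∧ E.IsInnerFace (cFace (cornerOrbit (E.bcBondConfig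 ω) a (i + 1)))) → medialPoint E.δ (cTgt (cornerOrbit (E.bcBondConfig ω) a n)) ∈ ball (meshPoint E.δ v) ρ → m ≤ n → (∀ i < k, medialPoint E.δ (cTgt (cornerOrbit ((shiftData E w).bcBondConfig ω) a' i)) ∉ ball (meshPoint E.δ v) ρ ∧ (shiftData E w).IsInnerFace (cFace (cornerOrbit ((shiftData E w).bcBondConfig ω) a' (i + 1)))) → cornerOrbit ((shiftData E w).bcBondConfig ω) a' k = cornerOrbit (E.bcBondConfig ω) a m → (∀ i < T, medialPoint E.δ (cTgt (cornerOrbit ((shiftData E w).bcBondConfig ω) (cornerOrbit (E.bcBondConfig ω) a m) i)) ∉ ball (meshPoint E.δ v) ρ ∧ (shiftData E w).IsInnerFace (cFace (cornerOrbit ((shiftData E w).bcBondConfig ω) (cornerOrbit (E.bcBondConfig ω) a m) (i + 1)))) → (medialPoint E.δ (cTgt (cornerOrbit ((shiftData E w).bcBondConfig ω) (cornerOrbit (E.bcBondConfig ω) a m) T)) ∈ ball (meshPoint E.δ v) ρ ∨ ¬ (shiftData E w).IsInnerFace (cFace (cornerOrbit ((shiftData E w).bcBondConfig ω) (cornerOrbit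 (E.bcBondConfig ω) a m) (T + 1)))) → ∃ j i : ℕ, j ≤ T ∧ i ≤ n ∧ cornerOrbit ((shiftData E w).bcBondConfig ω) (cornerOrbit (E.bcBondConfig ω) a m) j = cornerOrbit (E.bcBondConfig ω) a i ∧ (∀ i₁ i₂ : ℕ, i₁ ≤ n → i₂ ≤ n → cornerOrbit (E.bcBondConfig ω) a i₁ = cornerOrbit (E.bcBondConfig ω) a i₂ → i₁ = i₂) ∧ (∀ j', j < j' → j' ≤ T → ∀ i' ≤ n, cornerOrbit ((shiftData E w).bcBondConfig ω) (cornerOrbit (E.bcBondConfig ω) a m) j' ≠ cornerOrbit (E.bcBondConfig ω) a i') ∧ (j = 0 → i = m) ∧ (j < T → i < n ∧ cornerOrbit ((shiftData E w).bcBondConfig ω) (cornerOrbit (E.bcBondConfig ω) a m) (j + 1) ≠ cornerOrbit (E.bcBondConfig ω) a (i + 1) ∧ cSrc (cornerOrbit ((shiftData E w).bcBondConfig ω) (cornerOrbit (E.bcBondConfig ω) a m) (j + 1)) = cTgt (cornerOrbit (E.bcBondConfig ω) a i) ∧ cSrc (cornerOrbit (E.bcBondConfig ω) a (i + 1)) =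 cTgt (cornerOrbit (E.bcBondConfig ω) a i) ∧ ¬ (cTgt (cornerOrbit (E.bcBondConfig ω) a i) ∈ E.bcBondConfig ω ↔ cTgt (cornerOrbit (E.bcBondConfig ω) a i) ∈ (shiftData E w).bcBondConfig ω) ∧ turnOf ((shiftData E w).bcBondConfig ω) (cornerOrbit (E.bcBondConfig ω) a i) ≠ turnOf (E.bcBondConfig ω) (cornerOrbit (E.bcBondConfig ω) a i) ∧ infDist (meshPoint E.δ (cornerOrbit (E.bcBondConfig ω) a i).1) D.carrierᶜ < 3 * η ∧ ∃ x ∈ cTgt (cornerOrbit (E.bcBondConfig ω) a i), x ∈ E.zdArcA ∨ x ∈ E.zdArcB ∨ x ∈ (shiftData E w).zdArcA ∨ x ∈ (shiftData E w).zdArcB) ∧ (j = T → (medialPoint E.δ (cTgt (cornerOrbit ((shiftData E w).bcBondConfig ω) (cornerOrbit (E.bcBondConfig ω) a m) T)) ∈ ball (meshPoint E.δ v) ρ ∧ i = n) ∨ (¬ (shiftData E w).IsInnerFace (cFace (cornerOrbit ((shiftData E w).bcBondConfig ω) (cornerOrbit (E.bcBondConfig ω) a m) (T + 1))) ∧ cTgt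 (cornerOrbit (E.bcBondConfig ω) a i) ∉ (shiftData E w).bcBondConfig ω ∧ (cornerOrbit (E.bcBondConfig ω) a i).1 ∈ (shiftData E w).zdArcA ∧ (cornerOrbit (E.bcBondConfig ω) a i).1 + cornerUnit ((cornerOrbit (E.bcBondConfig ω) a i).2 + 1) ∈ (shiftData E w).zdArcB ∧ (shiftData E w).IsInEdge (cornerOrbit (E.bcBondConfig ω) a i).1 ((cornerOrbit (E.bcBondConfig ω) a i).2 + 1) ∧ cTgt (cornerOrbit (E.bcBondConfig ω) a i) ∈ (shiftData E w).zdABEdges ∧ (∀ q : Site 2 × Fin 4, q.1 ∈ (shiftData E w).zdArcA → q.1 + cornerUnit (q.2 + 1) ∈ (shiftData E w).zdArcB → (shiftData E w).IsInEdge q.1 (q.2 + 1) → q = cornerOrbit (E.bcBondConfig ω) a i) ∧ infDist (meshPoint E.δ (cornerOrbit (E.bcBondConfig ω) a i).1) D.carrierᶜ < 3 * η)) := by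
  intro D η hη
  obtain ⟨δ₁, hδ₁, hcollar⟩ := collarAgreement D η hη
  refine ⟨min δ₁ η, lt_min hδ₁ hη, ?_⟩
  intro E hEΩ hE hEδ v w ρ hηρ hv hw ω a a' n m k T hpair hStr hball hmn hStr₁ hek hrun hend
  have hδ : 0 < E.δ := hE.delta_pos
  have hδ₁' : E.δ < δ₁ := lt_of_lt_of_le hEδ (min_le_left _ _)
  have hδη : E.δ ≤ η := (lt_of_lt_of_le hEδ (min_le_right _ _)).le
  have hE₁ : (shiftData E w).IsZdAdmissible := isZdAdmissible_shiftData E w hE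
  set β₀ := E.bcBondConfig ω with hβ₀
  set β₁ := (shiftData E w).bcBondConfig ω with hβ₁
  set I : Set (Sym2 (Site 2)) := {x | medialPoint E.δ x ∈ ball (meshPoint E.δ v) ρ} with hI
  set e := cornerOrbit β₀ a m with hedef
  -- agreement at deep vertices
  have hagree : ∀ x : Site 2, 3 * η ≤ infDist (meshPoint E.δ x) D.carrierᶜ → ∀ (k' : Fin 4),
      (cTgt (x, k') ∈ β₀ ↔ cTgt (x, k') ∈ β₁) := fun x hx k' =>
    (no_discrepancy_of_agree hδ.le (hcollar E hEΩ hE hδ₁' w hw ω x hx) k' β₀).1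
  have hinner : ∀ x : Site 2, 3 * η ≤ infDist (meshPoint E.δ x) D.carrierᶜ → ∀ f : Site 2,
      IsCorner x f → E.IsInnerFace f ∧ (shiftData E w).IsInnerFace f := fun x hx =>
    (hcollar E hEΩ hE hδ₁' w hw ω x hx x (by rw [dist_self]; positivity)).2
  -- simplicity of the stretch
  have hsimple : ∀ i₁ i₂ : ℕ, i₁ ≤ n → i₂ ≤ n → cornerOrbit β₀ a i₁ = cornerOrbit β₀ a i₂ → i₁ = i₂ :=
    fun i₁ i₂ h1 h2 h => cornerOrbit_injOn_stretch (I := I) (fun i hi => (hStr i hi).1) hball h1 h2 h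
  -- the last contact
  obtain ⟨j, i, hjT, hin', hEq, hfree, hlt, hTend⟩ := lastContact β₀ β₁ I a e m n T hmn rfl
    (fun i hi => (hStr i hi).1) hball (fun j hj => (hrun j hj).1)
  -- faces along the two orbits are inner
  have hfaceE : ∀ i' ≤ n, E.IsInnerFace (cFace (cornerOrbit β₀ a i')) := by
    intro i' hi'
    rcases Nat.eq_zero_or_pos i' with rfl | hpos
    · rcases hpair with ⟨ha, -⟩ | ⟨-, haI, -⟩
      · exact ha.isOutEdge.1
      · exact (hinner a.1 (deep_of_cSrc_mem_ball hδ.le hδη hηρ hv haI) _ (isCorner_cFace a)).1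
    · obtain ⟨i'', rfl⟩ : ∃ i'', i' = i'' + 1 := ⟨i' - 1, by omega⟩
      exact (hStr i'' (by omega)).2
  have hface₁e : (shiftData E w).IsInnerFace (cFace e) := by
    rcases Nat.eq_zero_or_pos k with hk0 | hkpos
    · have hea : e = a' := by rw [← hek, hk0]; rfl
      rw [hea]
      rcases hpair with ⟨-, ha'⟩ | ⟨rfl, haI, -⟩
      · exact ha'.isOutEdge.1
      · exact (hinner a.1 (deep_of_cSrc_mem_ball hδ.le hδη hηρ hv haI) _ (isCorner_cFace a)).2
    · obtain ⟨k', rfl⟩ : ∃ k', k = k' + 1 := ⟨k - 1, by omega⟩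
      have := (hStr₁ k' (Nat.lt_succ_self k')).2
      rwa [hek] at this
  have hface₁ : ∀ j' ≤ T, (shiftData E w).IsInnerFace (cFace (cornerOrbit β₁ e j')) := by
    intro j' hj'
    rcases Nat.eq_zero_or_pos j' with rfl | hpos
    · exact hface₁e
    · obtain ⟨j'', rfl⟩ : ∃ j'', j' = j'' + 1 := ⟨j' - 1, by omega⟩
      exact (hrun j'' (by omega)).2
  refine ⟨j, i, hjT, hin', hEq, hsimple, hfree, fun hj0 => ?_, fun hjlt => ?_, fun hjE => ?_⟩
  · -- `j = 0`: the contact is `e = O₀ a m`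
    subst hj0
    exact (hsimple i m hin' hmn (hEq.symm.trans rfl)).symm ▸ rfl
  · -- `j < T`: a discrepancy edge, hence in the collar and on the arcs
    obtain ⟨hi, hne, hsrc₁, hsrc₀, hst, hturn⟩ := hlt hjlt
    have hcol : infDist (meshPoint E.δ (cornerOrbit β₀ a i).1) D.carrierᶜ < 3 * η := by
      by_contra hdeep
      rw [not_lt] at hdeep
      have := hagree _ hdeep (cornerOrbit β₀ a i).2
      rw [Prod.mk.eta] at this
      exact hst this
    have harcs := (ufrs_discrepancyEdges E w ω).1 (cornerOrbit β₀ a i) (hfaceE i hin')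
      (by rw [← hEq]; exact hface₁ j hjT) hst
    exact ⟨hi, hne, hsrc₁, hsrc₀, hst, hturn, hcol, harcs⟩
  · -- `j = T`: the run ends on the stretch
    rcases hend with hballT | hout
    · exact Or.inl ⟨hballT, hTend hjE hballT⟩
    · right
      -- the orbit of `a'` sits in an inner face at time `k + T` and not at `k + T + 1`
      have hin₁ : (shiftData E w).IsInnerFace (cFace (cornerOrbit β₁ a' (k + T))) := by
        rw [cornerOrbit_add_eq, hek]
        exact hface₁ T le_rfl
      have hout₁ : ¬ (shiftData E w).IsInnerFace (cFace (cornerOrbit β₁ a' (k + T + 1))) := by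
        rw [show k + T + 1 = k + (T + 1) by ring, cornerOrbit_add_eq, hek]
        exact hout
      have hexit : cTgt (cornerOrbit β₁ a' (k + T)) ∉ β₁ ∧
          (cornerOrbit β₁ a' (k + T)).1 ∈ (shiftData E w).zdArcA ∧
          (cornerOrbit β₁ a' (k + T)).1 + cornerUnit ((cornerOrbit β₁ a' (k + T)).2 + 1) ∈ (shiftData E w).zdArcB ∧
          (shiftData E w).IsInEdge (cornerOrbit β₁ a' (k + T)).1 ((cornerOrbit β₁ a' (k + T)).2 + 1) ∧
          cTgt (cornerOrbit β₁ a' (k + T)) ∈ (shiftData E w).zdABEdges := by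
        rcases orbit_exit_or_stuck hE₁ ω a' hin₁ hout₁ with ⟨haB, hstay⟩ | h
        · exfalso
          rcases hpair with ⟨-, ha'⟩ | ⟨rfl, haI, -⟩
          · exact Set.disjoint_left.1 hE₁.disjoint ha'.mem_zdArcA haB
          · apply hout₁
            have hv1 : (cornerOrbit β₁ a (k + T + 1)).1 = a.1 := hstay (k + T + 1) le_rfl
            have hc := isCorner_cFace (cornerOrbit β₁ a (k + T + 1))
            rw [hv1] at hc
            exact (hinner a.1 (deep_of_cSrc_mem_ball hδ.le hδη hηρ hv haI) _ hc).2
        · exact h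
      have hkT : cornerOrbit β₁ a' (k + T) = cornerOrbit β₀ a i := by
        rw [cornerOrbit_add_eq, hek, ← hjE]
        exact hEq
      rw [hkT] at hexit
      obtain ⟨hclosed, hA, hB, hIn, hAB⟩ := hexit
      have hcol : infDist (meshPoint E.δ (cornerOrbit β₀ a i).1) D.carrierᶜ < 3 * η := by
        by_contra hdeep
        rw [not_lt] at hdeep
        exact hIn.2 (hinner _ hdeep _ (isCorner_faceAt _ _)).2
      exact ⟨hout, hclosed, hA, hB, hIn, hAB, fun q hqA hqB hqIn =>
        exitCorner_unique hE₁ hqA hqB hqIn hA hB hIn, hcol⟩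

end

end Summit.CriticalPhenomena.CardyFormulaZ2.Cruxes.EdgePrecompact.QkzStripBoundaryArm
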